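import Literature.AlgebraicTopology.CharacteristicClasses.ProjectiveLerayHirsch
import Literature.AlgebraicTopology.CharacteristicClasses.ProjectiveBundleSplitting
import HarnessLib

/-!
# The Leray–Hirsch theorem for a projective bundle over a trivialising open set

Topic `Literature/AlgebraicTopology/CharacteristicClasses`. D. Husemoller, *Fibre Bundles*, 3rd
ed. (1994), Ch. 17 §1 Thm. 1.1 (proof: "Suppose `E = B × F`; then the theorem is a direct
consequence of the Künneth formula") and §2 (2.1)–(2.5) (the projective bundle `q : E(Pξ) → B`
is locally `U × ℂPⁿ⁻¹`, and the classes `1, a_ξ, …, a_ξⁿ⁻¹` restrict on each fibre to a base of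
`H*(ℂPⁿ⁻¹)`); A. Hatcher, *Algebraic Topology* (2002), proof of Thm. 4D.1 (the local step).

For a complex vector bundle `ξ = E` of rank `n₀` over `B`, its projective bundle
`q = E.projMap : P(E) = E.Proj → B` (`ProjectiveBundleSplitting`), a local trivialisation `e` of
`E` and an open `U ⊆ e.baseSet`:

* `powRep n₀ w` — cocycle representatives of the powers `wᵏ` (`k < n₀`) of a class `w ∈ H²`, with
  the representative of `w⁰ = 1` the constant cocycle `1`;
* `projChartInv E e U hU : ↥U × ℙ ℂ F → P(E)`, `(b, ℓ) ↦ ⟨b, ℙ(ẽ_b⁻¹) ℓ⟩`, the inverse of the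
  projectivised trivialisation: an embedding onto `q⁻¹U` over `U` (`isEmbedding_projChartInv`,
  `range_projChartInv`);
* **`isLHOn_chart`** — if a class `u ∈ H²(P(E); ℤ)` is PURE over `U`, i.e.
  `(projChartInv)* u = pr₂* x` for a generator `x` of `H²(ℙ ℂ F; ℤ)`, then the Leray–Hirsch
  comparison map of `q` for the family `1, u, …, u^{n₀-1}` is bijective over `U` through `q⁻¹U`
  (`LHSubset.IsLHOn`): transported (`LerayHirschTransport.isLHOn_of_isLHT`) from the theorem for
  `U × ℙ ℂ F` (`ProjectiveLHSubset.isLHT_prod_projectivization`), the two families of cocycles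
  being cohomologous on `U × ℙ ℂ F` by purity.

Everything is proved; no named facts.

## References

* [HusemollerFibreBundles1994] D. Husemoller, *Fibre Bundles*, 3rd ed. (1994), Ch. 17 §1 Thm. 1.1,
  §2 (2.1)–(2.5), Thm. 2.5.
* [HatcherAT2002] A. Hatcher, *Algebraic Topology*, CUP 2002, Thm. 4D.1 (proof).
-/

noncomputable section

-- as in `ProjectiveLerayHirsch`: chains of the concrete complex are `Finsupp`s up to unfolding
-- of semireducible definitions
set_option backward.isDefEq.respectTransparency false

open CategoryTheory Function Set Module Bundle Topology
open Literature.AlgebraicTopology.SingularHomology Literature.AlgebraicTopology.SingularHomology.subsetCochains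
  Literature.Topology.FourManifolds
open scoped LinearAlgebra.Projectivization

namespace Literature.AlgebraicTopology.CharacteristicClasses

/-- Local notation: the coefficient object `ULift ℤ` of `ModuleCat ℤ`. -/
local notation "𝑹" => SimplexSpan.coefR ℤ

/-! ### Pull-backs over equal source sets -/

/-- Bijectivity of `f*` onto `H*_X(S)` is invariant under an equality `S = S'`. [folklore] -/
theorem bijective_pullH_set_congr {X Y : Type} [TopologicalSpace X] [TopologicalSpace Y] (f : C(X, Y)) {S S' : Set X}
    {W : Set Y} (h : S = S') (hm : MapsTo f S W) (hm' : MapsTo f S' W) (p : ℕ) :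
    Function.Bijective (pullH (N := 𝑹) f hm p) ↔ Function.Bijective (pullH (N := 𝑹) f hm' p) := by
  subst h
  exact Iff.rfl

/-! ### Cocycle representatives of the powers of a degree-two class -/

section PowReps

variable {Y : Type} [TopologicalSpace Y]

/-- Every class has a cocycle representative (`clsOfCocycle` form). [folklore] -/
theorem exists_clsOfCocycle_eq {k : ℕ} (x : singularCohomology ℤ ℤ Y k) :
    ∃ (φ : SingularSimplex Y k → ℤ) (hφ : (singularCochainComplex ℤ ℤ Y).d k (k + 1) φ = 0), clsOfCocycle φ hφ = x := by
  obtain ⟨φ, hφ', hφ⟩ := homologyCls_surjective (K := singularCochainComplex ℤ ℤ Y) (i := k) x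
  exact ⟨φ, (d_next_eq_zero_iff (up_next k) φ).1 hφ', (homologyCls_congr rfl _ _).trans hφ⟩

/-- `clsOfCocycle` only depends on the cochain. [folklore] -/
theorem clsOfCocycle_congr {k : ℕ} {φ φ' : SingularSimplex Y k → ℤ} (h : φ = φ')
    (hφ : (singularCochainComplex ℤ ℤ Y).d k (k + 1) φ = 0) (hφ' : (singularCochainComplex ℤ ℤ Y).d k (k + 1) φ' = 0) :
    clsOfCocycle φ hφ = clsOfCocycle φ' hφ' := by
  subst h
  rfl

/-- `[φ - φ'] = [φ] - [φ']`. [folklore] -/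
theorem clsOfCocycle_sub {k : ℕ} (φ φ' : SingularSimplex Y k → ℤ)
    (hφ : (singularCochainComplex ℤ ℤ Y).d k (k + 1) φ = 0) (hφ' : (singularCochainComplex ℤ ℤ Y).d k (k + 1) φ' = 0)
    (h : (singularCochainComplex ℤ ℤ Y).d k (k + 1) (φ - φ') = 0) :
    clsOfCocycle (φ - φ') h = clsOfCocycle φ hφ - clsOfCocycle φ' hφ' :=
  homologyCls_sub (K := singularCochainComplex ℤ ℤ Y) φ φ' _ _ _

variable (n₀ : ℕ) (w : singularCohomology ℤ ℤ Y 2)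

/-- **Cocycle representatives of the powers `wᵏ`, `k < n₀`**, the power `w⁰ = 1` being represented
by the constant cocycle `1` (Husemoller Ch. 17 §1: the classes `aᵢ` of the Leray–Hirsch theorem,
here `1, a, …, aⁿ⁻¹`). [cite: HusemollerFibreBundles1994, Ch. 17 §1 Thm. 1.1] -/
def powRep (k : Fin n₀) : SingularSimplex Y (2 * (k : ℕ)) → ℤ :=
  if (k : ℕ) = 0 then fun _ ↦ 1 else Classical.choose (exists_clsOfCocycle_eq (cupPowL w k))

/-- The representative of `w⁰` is the constant `1`. [folklore] -/
theorem powRep_zero (k : Fin n₀) (hk : (k : ℕ) = 0) (σ : SingularSimplex Y (2 * (k : ℕ))) : powRep n₀ w k σ = 1 := by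
  rw [powRep, if_pos hk]

/-- The representatives are cocycles. [folklore] -/
theorem powRep_d (k : Fin n₀) :
    (singularCochainComplex ℤ ℤ Y).d (2 * (k : ℕ)) (2 * (k : ℕ) + 1) (powRep n₀ w k) = 0 := by
  by_cases hk : (k : ℕ) = 0
  · obtain ⟨kv, hkv⟩ := k
    change kv = 0 at hk
    subst hk
    have : powRep n₀ w ⟨0, hkv⟩ = cochainOne ℤ Y := funext fun σ ↦ powRep_zero n₀ w _ rfl σ
    rw [this]
    exact d_cochainOne ℤ
  · rw [powRep, if_neg hk]
    exact (Classical.choose_spec (exists_clsOfCocycle_eq (cupPowL w k))).fst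

/-- **The representatives represent the powers: `[powRep k] = wᵏ`.** [folklore] -/
theorem clsOfCocycle_powRep (k : Fin n₀) : clsOfCocycle (powRep n₀ w k) (powRep_d n₀ w k) = cupPowL w k := by
  by_cases hk : (k : ℕ) = 0
  · obtain ⟨kv, hkv⟩ := k
    change kv = 0 at hk
    subst hk
    have h1 : powRep n₀ w ⟨0, hkv⟩ = cochainOne ℤ Y := funext fun σ ↦ powRep_zero n₀ w _ rfl σ
    rw [clsOfCocycle_congr h1 _ (d_cochainOne ℤ)]
    exact clsOfCocycle_cochainOne _
  · have h1 : powRep n₀ w k = Classical.choose (exists_clsOfCocycle_eq (cupPowL w k)) := by rw [powRep, if_neg hk]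
    rw [clsOfCocycle_congr h1 _ (Classical.choose_spec (exists_clsOfCocycle_eq (cupPowL w k))).fst]
    exact (Classical.choose_spec (exists_clsOfCocycle_eq (cupPowL w k))).snd

end PowReps

/-! ### The inverse of a projectivised trivialisation -/

section Chart

open ComplexVectorBundle

variable {B : Type} [TopologicalSpace B] (E : ComplexVectorBundle.{0, 0} B)
  (e : Trivialization E.F (π E.F E.E)) [MemTrivializationAtlas e] (U : Set B) (hU : U ⊆ e.baseSet)

/-- **The inverse projectivised trivialisation `↥U × ℙ ℂ F → P(E)`, `(b, ℓ) ↦ ⟨b, ℙ(ẽ_b⁻¹) ℓ⟩`**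
over `U ⊆ e.baseSet` (Husemoller Ch. 17 §2 Def. 2.1: `P(ξ)` is locally trivial).
[cite: HusemollerFibreBundles1994, Ch. 17 §2 Def. 2.1] -/
def projChartInv : C(↥U × ℙ ℂ E.F, E.Proj) where
  toFun x := (projTrivialization ℂ E.F E.E e).toOpenPartialHomeomorph.symm ((x.1 : B), x.2)
  continuous_toFun := by
    refine (projTrivialization ℂ E.F E.E e).toOpenPartialHomeomorph.continuousOn_symm.comp_continuous
      ((continuous_subtype_val.comp continuous_fst).prodMk continuous_snd) fun x ↦ ?_
    rw [(projTrivialization ℂ E.F E.E e).target_eq, projTrivialization_baseSet]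
    exact ⟨hU x.1.2, mem_univ _⟩

/-- The chart inverse lies over `U`: `q ∘ projChartInv = pr₁`. [folklore] -/
@[simp]
theorem projMap_projChartInv (x : ↥U × ℙ ℂ E.F) : E.projMap (projChartInv E e U hU x) = (x.1 : B) := rfl

/-- The projectivised trivialisation inverts the chart inverse. [folklore] -/
theorem projTrivialization_projChartInv (x : ↥U × ℙ ℂ E.F) :
    projTrivialization ℂ E.F E.E e (projChartInv E e U hU x) = ((x.1 : B), x.2) := by
  apply (projTrivialization ℂ E.F E.E e).toOpenPartialHomeomorph.right_inv
  rw [(projTrivialization ℂ E.F E.E e).target_eq, projTrivialization_baseSet]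
  exact ⟨hU x.1.2, mem_univ _⟩

/-- The chart inverse inverts the projectivised trivialisation over `U`. [folklore] -/
theorem projChartInv_projTrivialization (p : E.Proj) (hp : E.projMap p ∈ U) :
    projChartInv E e U hU (⟨E.projMap p, hp⟩, (projTrivialization ℂ E.F E.E e p).2) = p := by
  have hsrc : p ∈ (projTrivialization ℂ E.F E.E e).source := by
    rw [projTrivialization_source]
    exact hU hp
  change (projTrivialization ℂ E.F E.E e).toOpenPartialHomeomorph.symm (E.projMap p, (projTrivialization ℂ E.F E.E e p).2) = p
  have h1 : (E.projMap p, (projTrivialization ℂ E.F E.E e p).2) = projTrivialization ℂ E.F E.E e p :=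
    Prod.ext ((projTrivialization ℂ E.F E.E e).coe_fst hsrc).symm rfl
  rw [h1]
  exact (projTrivialization ℂ E.F E.E e).toOpenPartialHomeomorph.left_inv hsrc

/-- **The image of the chart inverse is `q⁻¹U`.** [folklore] -/
theorem range_projChartInv : range (projChartInv E e U hU) = E.projMap ⁻¹' U := by
  ext p
  constructor
  · rintro ⟨x, rfl⟩
    exact x.1.2
  · intro hp
    exact ⟨_, projChartInv_projTrivialization E e U hU p hp⟩

/-- **The chart inverse is an embedding** (it is inverted by the projectivised trivialisation on
the open set `q⁻¹U`). [folklore] -/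
theorem isEmbedding_projChartInv : IsEmbedding (projChartInv E e U hU) := by
  -- corestrict to the open subspace `q⁻¹U`, where a continuous left inverse exists
  let j' : ↥U × ℙ ℂ E.F → ↥(E.projMap ⁻¹' U) := fun x ↦ ⟨projChartInv E e U hU x, x.1.2⟩
  have hj' : Continuous j' := (projChartInv E e U hU).continuous.subtype_mk _
  let f' : ↥(E.projMap ⁻¹' U) → ↥U × ℙ ℂ E.F := fun p ↦ (⟨E.projMap p.1, p.2⟩, (projTrivialization ℂ E.F E.E e p.1).2)
  have hf' : Continuous f' := by
    refine ((E.projMap.continuous.comp continuous_subtype_val).subtype_mk _).prodMk ?_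
    have hc : ContinuousOn (fun p : E.Proj ↦ (projTrivialization ℂ E.F E.E e p).2) (E.projMap ⁻¹' U) :=
      (continuous_snd.comp_continuousOn (projTrivialization ℂ E.F E.E e).continuousOn).mono (by
        rw [projTrivialization_source]
        exact preimage_mono hU)
    exact hc.comp_continuous continuous_subtype_val fun p ↦ p.2
  have hleft : LeftInverse f' j' := fun x ↦
    Prod.ext (Subtype.ext rfl)
      (show (projTrivialization ℂ E.F E.E e (projChartInv E e U hU x)).2 = x.2 from
        congrArg Prod.snd (projTrivialization_projChartInv E e U hU x))
  have hemb : IsEmbedding j' := IsEmbedding.of_leftInverse hleft hf' hj'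
  exact IsEmbedding.subtypeVal.comp hemb

/-- `j*` along the chart inverse is bijective from `H*_{P(E)}(q⁻¹U)` onto `H*(↥U × ℙ ℂ F)`. [cite: HatcherAT2002, §2.1 p. 111] -/
theorem pullH_projChartInv_bijective
    (hm : MapsTo (projChartInv E e U hU) (univ : Set (↥U × ℙ ℂ E.F)) (E.projMap ⁻¹' U)) (p : ℕ) :
    Function.Bijective (pullH (N := 𝑹) (projChartInv E e U hU) hm p) := by
  have hset : (projChartInv E e U hU) ⁻¹' (E.projMap ⁻¹' U) = univ :=
    eq_univ_of_forall fun x ↦ x.1.2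
  have key := pullH_bijective_of_isEmbedding ℤ 𝑹 (projChartInv E e U hU) (isEmbedding_projChartInv E e U hU)
    (W := E.projMap ⁻¹' U) (by rw [range_projChartInv]) p
  exact (bijective_pullH_set_congr (projChartInv E e U hU) hset _ hm p).1 key

end Chart

/-! ### Leray–Hirsch over a trivialising open set, for a pure class -/

section Local

open ComplexVectorBundle

variable {B : Type} [TopologicalSpace B] (E : ComplexVectorBundle.{0, 0} B)
  (e : Trivialization E.F (π E.F E.E)) [MemTrivializationAtlas e] (U : Set B) (hU : U ⊆ e.baseSet)

/-- **Leray–Hirsch for `q : P(E) → B` over a trivialising open set `U`, for a pure class `u`**: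
if `u ∈ H²(P(E); ℤ)` restricts on the trivialised piece `↥U × ℙ ℂ F ≅ q⁻¹U` to `pr₂* x` for a
generator `x` of `H²(ℙ ℂ F; ℤ)`, then the comparison map
`θ_U : ⊕_{k < n₀, e} Hᵉ_B(U) → H*_{P(E)}(q⁻¹U)`, `θ(c) = Σ q*(c_{k,e}) ⌣ uᵏ` (`rank E = n₀`), is
bijective (Husemoller Ch. 17 §1 Thm. 1.1, the case of a trivial bundle, with §2 Thm. 2.5 for the
fibre `ℂPⁿ⁻¹`). [cite: HusemollerFibreBundles1994, Ch. 17 §1 Thm. 1.1 (proof), §2 Thm. 2.5] -/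
theorem isLHOn_chart {n₀ : ℕ} (hn₀ : 1 ≤ n₀) (hr : E.rank = n₀) (u : singularCohomology ℤ ℤ E.Proj 2)
    (x : singularCohomology ℤ ℤ (ℙ ℂ E.F) 2) (hx : Submodule.span ℤ {x} = ⊤)
    (hpure : singularCohomology.map ℤ ℤ (projChartInv E e U hU) 2 u =
      singularCohomology.map ℤ ℤ (ContinuousMap.snd : C(↥U × ℙ ℂ E.F, ℙ ℂ E.F)) 2 x) :
    LHSubset.IsLHOn (R := ℤ) E.projMap (lhDeg n₀) (powRep n₀ u) (powRep_d n₀ u) U (E.projMap ⁻¹' U)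
      (mapsTo_preimage_left E.projMap U) := by
  have hqj : ∀ y : ↥U × ℙ ℂ E.F, E.projMap (projChartInv E e U hU y) = ((prT ↥U y) : B) := fun _ ↦ rfl
  -- the transported cocycles `j^♯ powRep u`
  let β₁ : (k : Fin n₀) → SingularSimplex (↥U × ℙ ℂ E.F) (2 * (k : ℕ)) → ℤ := fun k ↦
    (singularCochainComplex.map ℤ ℤ (projChartInv E e U hU)).f (2 * (k : ℕ)) (powRep n₀ u k)
  have hβ₁ : ∀ k : Fin n₀, (singularCochainComplex ℤ ℤ (↥U × ℙ ℂ E.F)).d (2 * (k : ℕ)) (2 * (k : ℕ) + 1) (β₁ k) = 0 :=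
    fun k ↦ map_d_eq_zero _ _ (powRep_d n₀ u k)
  refine isLHOn_of_isLHT E.projMap U (prT ↥U) (projChartInv E e U hU) hqj (lhDeg n₀) (powRep n₀ u) (powRep_d n₀ u)
    β₁ hβ₁ (fun _ ↦ rfl) (pullH_projChartInv_bijective E e U hU _) ?_
  -- Leray–Hirsch for `↥U × ℙ ℂ F` with the fibre cocycles `pr₂^♯ powRep x`
  have hV : finrank ℂ E.F = n₀ := hr
  have hprod := isLHT_prod_projectivization hV hn₀ x hx (powRep n₀ x) (powRep_d n₀ x) (powRep_zero n₀ x)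
    (clsOfCocycle_powRep n₀ x) ↥U
  -- the two families act alike: equal for `k = 0`, cohomologous for `k ≥ 1` (purity)
  have hsame : SameActionOn (lhDeg n₀) β₁ (fibCocycle ↥U (powRep n₀ x)) hβ₁ (fibCocycle_d ↥U (powRep n₀ x) (powRep_d n₀ x))
      (univ : Set (↥U × ℙ ℂ E.F)) := by
    apply sameActionOn_of_cohomologous
    intro k
    by_cases hk : (k : ℕ) = 0
    · left
      funext σ
      change powRep n₀ u k (σ.map (projChartInv E e U hU)) = powRep n₀ x k (σ.map ContinuousMap.snd)
      rw [powRep_zero n₀ u k hk, powRep_zero n₀ x k hk]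
    · right
      -- the classes agree by purity
      have hcls : clsOfCocycle (β₁ k) (hβ₁ k) =
          clsOfCocycle (fibCocycle ↥U (powRep n₀ x) k) (fibCocycle_d ↥U (powRep n₀ x) (powRep_d n₀ x) k) := by
        have h1 : clsOfCocycle (β₁ k) (hβ₁ k) = singularCohomology.map ℤ ℤ (projChartInv E e U hU) (2 * (k : ℕ))
            (clsOfCocycle (powRep n₀ u k) (powRep_d n₀ u k)) :=
          clsOfCocycle_map (projChartInv E e U hU) (powRep n₀ u k) (powRep_d n₀ u k)
        rw [h1, clsOfCocycle_powRep, map_cupPowL, hpure, ← map_cupPowL, ← clsOfCocycle_powRep n₀ x k]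
        exact (clsOfCocycle_fibCocycle ↥U (powRep n₀ x) (powRep_d n₀ x) k).symm
      have hd : (singularCochainComplex ℤ ℤ (↥U × ℙ ℂ E.F)).d (2 * (k : ℕ)) (2 * (k : ℕ) + 1)
          (β₁ k - fibCocycle ↥U (powRep n₀ x) k) = 0 := by
        rw [map_sub, hβ₁ k, fibCocycle_d ↥U (powRep n₀ x) (powRep_d n₀ x) k, sub_zero]
      have h0 : clsOfCocycle _ hd = 0 := by
        rw [clsOfCocycle_sub _ _ (hβ₁ k) (fibCocycle_d ↥U (powRep n₀ x) (powRep_d n₀ x) k), hcls, sub_self]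
      obtain ⟨e', he', α, hα⟩ := exists_eq_d_of_clsOfCocycle_eq_zero (by omega) _ hd h0
      exact ⟨e', he', α, hα⟩
  rw [isLHT_iff_isLHTR_bot] at hprod ⊢
  exact (isLHTR_congr (prT ↥U) (lhDeg n₀) _ _ _ _ hsame _).2 hprod

end Local

end Literature.AlgebraicTopology.CharacteristicClasses
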